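import Summits.HodgeConjecture.CorCM.Census.CyclicCharacterNonrootLawK
import Summits.HodgeConjecture.CorCM.Census.CyclicCharacterCommutator
import Summits.HodgeConjecture.CorCM.Census.IndexTwoCyclicTwoGroups
import Summits.HodgeConjecture.CorCM.Census.CyclicCharacterBlockCount

/-!
# Cyclic characters, XLIX: THE COMMUTATOR LAW — `μ(G, c) = φ₂(G, c)` for EVERY central involution OUTSIDE the commutator subgroup

COR-CM (cell `pub-hodgecm2`), count-neutral kernel combinatorics by the binder seat b09 (gen 44; lane CYCLIC-CHARACTER FIBRE LAW, part XLIX — the lane's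
capstone), assembling BY NAME: gen 41ʼs cyclic character of an involution outside `[G, G]` (`Census/CyclicCharacterCommutator`), the complemented law
(`Census/ComplementFacesGenerate.isLeast_card_gfaces_generate_fibreTwo_of_cpl`, level `k = 1`), the complete cyclic-character law of part XLVIII (level
`k ≥ 2`, `|ker w| ≥ 3`), and for the tiny kernels `|ker w| ≤ 2` the cyclic law and the 2-groups with a cyclic subgroup of index two
(`Census/IndexTwoCyclicTwoGroups`, with `|G| = 2ᵏ·|ker w|` from `Census/CyclicCharacterBlockCount`).  Theorems only (no definition, no `decide`, no certificate data, no named fact, no `sorry`).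
HONEST FRAMING: `HC_CM` is NOT proved, here or anywhere in the tree; nothing here is a period or a headline.

**THE COMMUTATOR LAW (`isLeast_card_gfaces_generate_fibreTwo_of_notMem_commutator`).**  For every finite group `G` and every central involution `c`
with `c ∉ [G, G]` (so `c ≠ 1`): the least number of G-faces whose translates together with the pairs generate the Hodge span is EXACTLY the coinvariant floor,
`μ(G, c) = φ₂(G, c)`.  (By gen 41ʼs trichotomy `φ₂ ∈ {β − 2, β − 1, β}` there; all three values occur.)  The complementary world `c ∈ [G, G]` — where
lit-andre-3ʼs divided parities `d₂ ≥ 2` live — is not touched.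

## References
* [Pohlmann1968] H. Pohlmann, Algebraic cycles on abelian varieties of complex multiplication type, Ann. of Math. 88 (1968), Thm 1.
-/

namespace Summit.HodgeConjecture.CorCM.Census.CyclicCharacter

open Finset
open Summit.HodgeConjecture.CorCM.Prior.AllgGroup.RfwfAllgGroup
open Summit.HodgeConjecture.CorCM.Census.BlockParity
open Summit.HodgeConjecture.CorCM.Census.Coinvariant
open Summit.HodgeConjecture.CorCM.Census.TwistGeneration
open Summit.HodgeConjecture.CorCM.Census.BaseBlock

noncomputable section

variable {G : Type*} [Group G] [Fintype G] [DecidableEq G] {k : ℕ} {w : G → ZMod (2 ^ k)} {c : G}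

omit [Fintype G] [DecidableEq G] in
/-- **`2ᵏ` divides the order of a `w`-generator**: if `w : G → ℤ/2ᵏ` is additive and `w g₁ = 1` then `2ᵏ ∣ orderOf g₁` (finite `G`). [folklore] -/
theorem two_pow_dvd_orderOf [Finite G] (hw : ∀ P Q : G, w (P * Q) = w P + w Q) {g₁ : G} (hg₁ : w g₁ = 1) : 2 ^ k ∣ orderOf g₁ := by
  have h := map_pow hw g₁ (orderOf g₁)
  rw [pow_orderOf_eq_one, map_one hw, hg₁, Nat.smul_one_eq_cast] at h
  exact (ZMod.natCast_eq_zero_iff _ _).mp h.symm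

/-- **TINY KERNELS: `|ker w| ≤ 2` (`k ≥ 2`) ⇒ `μ(G, c) = φ₂(G, c)`** — then `G` is a 2-group of order `2ᵏ·|ker w|` in which `⟨g₁⟩` (`w g₁ = 1`) has index
`≤ 2`: the cyclic law or the law of the 2-groups with a cyclic subgroup of index two. [folklore] -/
theorem isLeast_card_gfaces_generate_of_card_ker_le_two (hw : ∀ P Q : G, w (P * Q) = w P + w Q) (hk2 : 2 ≤ k)
    (hc2 : c * c = 1) (hc1 : c ≠ 1) (hcen : ∀ x : G, x * c = c * x) (h1 : ∃ g₁ : G, w g₁ = 1)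
    (h2 : (univ.filter fun s : G => w s = 0).card ≤ 2) :
    IsLeast {n : ℕ | ∃ S : Finset (CMF G c →₀ ℤ), (↑S ⊆ gfaceSet G c hc2) ∧ S.card = n ∧
      hodgeSpan c hc2 ≤ Submodule.span ℤ (pairSet c) ⊔ Submodule.span ℤ (translates c S)} (fibreTwo c hc2) := by
  classical
  obtain ⟨g₁, hg₁⟩ := h1
  obtain ⟨K, hK⟩ := exists_ker hw
  have hKc : Nat.card K = (univ.filter fun s : G => w s = 0).card := by
    rw [Nat.card_eq_fintype_card, show Fintype.card K = Fintype.card {x // x ∈ K} from rfl, Fintype.card_subtype]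
    exact congrArg card (filter_congr fun x _ => hK x)
  have hK1 : 1 ≤ (univ.filter fun s : G => w s = 0).card := card_pos.mpr ⟨1, mem_filter.mpr ⟨mem_univ _, map_one hw⟩⟩
  have hG : Nat.card G = 2 ^ k * Nat.card K := card_eq_two_pow_mul_card_ker hw ⟨g₁, hg₁⟩ hK
  have hdvd : 2 ^ k ∣ orderOf g₁ := two_pow_dvd_orderOf hw hg₁
  have hodvd : orderOf g₁ ∣ Nat.card G := orderOf_dvd_natCard g₁
  have hidx : orderOf g₁ * (Subgroup.zpowers g₁).index = Nat.card G := by rw [← Nat.card_zpowers]; exact (Subgroup.zpowers g₁).card_mul_index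
  have hcyc : orderOf g₁ = Nat.card G → IsLeast {n : ℕ | ∃ S : Finset (CMF G c →₀ ℤ), (↑S ⊆ gfaceSet G c hc2) ∧ S.card = n ∧
      hodgeSpan c hc2 ≤ Submodule.span ℤ (pairSet c) ⊔ Submodule.span ℤ (translates c S)} (fibreTwo c hc2) := fun h => by
    haveI : IsCyclic G := isCyclic_iff_exists_orderOf_eq_natCard.mpr ⟨g₁, h⟩
    exact IndexTwoCyclic.isLeast_card_gfaces_generate_fibreTwo_of_isCyclic hc2 hc1
  have h2k : 0 < 2 ^ k := Nat.two_pow_pos k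
  rcases (show Nat.card K = 1 ∨ Nat.card K = 2 by omega) with hK' | hK'
  · -- `|G| = 2ᵏ = orderOf g₁`: cyclic
    rw [hK', mul_one] at hG
    refine hcyc (Nat.dvd_antisymm hodvd ?_)
    rw [hG]; exact hdvd
  · -- `|G| = 2ᵏ⁺¹`, `orderOf g₁ ∈ {2ᵏ, 2ᵏ⁺¹}`
    rw [hK', ← pow_succ] at hG
    obtain ⟨t, ht⟩ := hdvd
    have htd : t ∣ 2 := by
      have h := hodvd; rw [hG, ht, pow_succ] at h
      exact Nat.dvd_of_mul_dvd_mul_left h2k h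
    rcases (Nat.dvd_prime Nat.prime_two).mp htd with rfl | rfl
    · -- `orderOf g₁ = 2ᵏ`: index two
      rw [mul_one] at ht
      have hindex : (Subgroup.zpowers g₁).index = 2 := by
        have h := hidx; rw [hG, ht, pow_succ] at h
        exact Nat.eq_of_mul_eq_mul_left h2k h
      have hcard : Fintype.card G = 2 ^ (k + 1) := by rw [← Nat.card_eq_fintype_card, hG]
      exact IndexTwoCyclic.isLeast_card_gfaces_generate_fibreTwo_of_two_group hc2 hc1 hcen g₁ hcard (by omega) hindex
    · exact hcyc (by rw [ht, hG, pow_succ])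

/-- **THE COMMUTATOR LAW: `μ(G, c) = φ₂(G, c)` for every finite group `G` and every central involution `c` outside the commutator subgroup** (`c² = 1`,
`c ∉ [G, G]`, so `c ≠ 1`).
[folklore] -/
theorem isLeast_card_gfaces_generate_fibreTwo_of_notMem_commutator (hc2 : c * c = 1) (hcen : ∀ x : G, x * c = c * x)
    (hc : c ∉ commutator G) :
    IsLeast {n : ℕ | ∃ S : Finset (CMF G c →₀ ℤ), (↑S ⊆ gfaceSet G c hc2) ∧ S.card = n ∧
      hodgeSpan c hc2 ≤ Submodule.span ℤ (pairSet c) ⊔ Submodule.span ℤ (translates c S)} (fibreTwo c hc2) := by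
  classical
  have hc1 : c ≠ 1 := fun h => hc (h ▸ (commutator G).one_mem)
  obtain ⟨k, hk, w, hw, h1, hwc⟩ := exists_cyclicCharacter_of_notMem_commutator hc2 hc
  by_cases hk1 : k = 1
  · subst hk1
    obtain ⟨K, hK⟩ := exists_ker hw
    exact ComplementFaces.isLeast_card_gfaces_generate_fibreTwo_of_cpl c (isComplement_ker_of_level_one hw hwc hK) hc2 hc1 hcen
  · have hk2 : 2 ≤ k := by omega
    by_cases h3 : 3 ≤ (univ.filter fun s : G => w s = 0).card
    · exact isLeast_card_gfaces_generate_of_cyclicCharacter hw hk hk2 hc2 hcen hwc h1 h3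
    · exact isLeast_card_gfaces_generate_of_card_ker_le_two hw hk2 hc2 hc1 hcen h1 (by omega)

/-- **THE COMMUTATOR LAW, uniqueness form**: under the same hypotheses every least generating number equals `φ₂(G, c)`. [folklore] -/
theorem eq_fibreTwo_of_isLeast_of_notMem_commutator (hc2 : c * c = 1) (hcen : ∀ x : G, x * c = c * x)
    (hc : c ∉ commutator G) {μ : ℕ}
    (hμ : IsLeast {n : ℕ | ∃ S : Finset (CMF G c →₀ ℤ), (↑S ⊆ gfaceSet G c hc2) ∧ S.card = n ∧
      hodgeSpan c hc2 ≤ Submodule.span ℤ (pairSet c) ⊔ Submodule.span ℤ (translates c S)} μ) : μ = fibreTwo c hc2 :=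
  hμ.unique (isLeast_card_gfaces_generate_fibreTwo_of_notMem_commutator hc2 hcen hc)

end

end Summit.HodgeConjecture.CorCM.Census.CyclicCharacter
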